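import Summits.BirchSwinnertonDyer.BirchSwinnertonDyer.Theses.ResidualThetaTransportAtTwo
import Summits.BirchSwinnertonDyer.BirchSwinnertonDyer.Theorems.ResidualThetaTransportAtTwoSignedMuVanishingAtTwoPlusLineV47
import Summits.BirchSwinnertonDyer.BirchSwinnertonDyer.Theorems.ResidualThetaTransportAtTwoSignedMuVanishingAtTwoPlusTorsionClause
import Summits.BirchSwinnertonDyer.BirchSwinnertonDyer.Theorems.ResidualThetaTransportAtTwoSignedMuVanishingAtTwoPlusNecessityFine
import Summits.BirchSwinnertonDyer.BirchSwinnertonDyer.Theorems.ResidualThetaTransportAtTwoThetaLayerLambdaCongruenceAtTwoCuspSpanArtinERH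
import HarnessLib

/-!
# Crux Kμ⁺ `SignedMuVanishingAtTwoPlus` (stmt-BirchSwinnertonDyer-20689), line `birth` v4.8 — THE READING OF RECORD:
# granted {GZK, PUB⁵, Hooley–Lenstra–Moree} (print) and ERH, the crux IS «`μ(X⁺(W/ℚ_∞)) = 0` at `2` on the habitat⁺»

Cell `bsd-wall`, lead `bsd-wall-rtt-p4` g8 (helper, `--supports stmt-BirchSwinnertonDyer-20689`; THEOREMS ONLY — no `def`, no
named fact, no `sorry`). BSD is not proved by this; nothing is closed; ERH and GZK are open / unproved in the tree.

This file composes the three g8 helpers (`…LineV47` p632471, `…TorsionClause` p634256, `…NecessityFine` p634252) with the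
extra width seat rtt-p3-w5 g0's ERH closer of the node (`SignedMuAtTwo.artinProgression_of_ERH` /
`cuspSpanEvenAtTwoOdd_of_ERH`, p631518, over the relocated print fact
`Literature.NumberTheory.Multiplicative.lenstra1977_exists_prime_two_primitiveRoot_progression_of_ERH`, p631516):

* `signedMuAnalyticAtTwoPlus_of_pub_of_ERH` — the analytic child 21437 from {PUB⁵ item 27435, Lenstra 1977 (8.3) (print), ERH};
* `signedMuVanishingAtTwoPlus_of_seed_of_pub_of_ERH`, `signedMuVanishingAtTwoPlus_iff_seed_of_pub_of_ERH` — the crux from / iff the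
  seed item 21438, granted {PUB⁵, Lenstra (print), ERH};
* `signedMuVanishingAtTwoPlus_iff_mu_eq_zero_of_GZK_of_pub_of_ERH` — **granted {GZK, PUB⁵, Lenstra 1977 (8.3)} (print facts by
  name) and ERH, the crux Kμ⁺ ⟺ «for every habitat⁺ curve `W`, every cyclotomic `κ, γ` and every finitely generated `+` signed
  Selmer dual datum `D`: `μ(D.X) = 0`»** — torsion (Kobayashi Thm. 1.2 shape) from GZK + Poitou–Tate, the analytic half
  (`μ(ϖ L⁺_W) = m`) from the cusp-span node under ERH, the algebraic μ-clause being the ONLY research residue;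
* `fineResidualFinite_of_mu_eq_zero` — and that residue FORCES residual Conjecture A at `2` (`Sel₀(W/ℚ_∞)[2]` finite) on the
  habitat⁺ (its (F)-half; by crux-ideate k1g8's E1 = Iwasawa's `μ₂ = 0` for the cubic 2-division field `L_W`, barrier-class for
  the unbounded `∀`).

References: [Greenberg1999LNM] Conj. 1.11; [Kobayashi2003] Thm. 1.2; [CoatesSujatha2005] Conj. A; [Lenstra1977] Thm. (8.3);
[Moree1999] Thm. 2, 4; [AbbesUllmo1996] Thm. A; [Kolyvagin1990] Thm. A; [GrossZagier1986] Thm. I.6.3; [Pollack2003] Conj. 6.3.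
-/

set_option autoImplicit false
-- justification: the `Summit.BirchSwinnertonDyer.BirchSwinnertonDyer.…` path repeats a component (route-file convention)
set_option linter.dupNamespace false

noncomputable section

open scoped Classical

open WeierstrassCurve Literature.NumberTheory.EllipticCurves Literature.NumberTheory.EllipticCurves.Rank1Residual
  Literature.NumberTheory.EllipticCurves.Kobayashi2003 ZpExtension
  Literature.NumberTheory.EllipticCurves.ModularForms
  Summit.BirchSwinnertonDyer.BirchSwinnertonDyer.Theses.ResidualThetaTransportAtTwo

namespace Summit.BirchSwinnertonDyer.BirchSwinnertonDyer.Theorems.SignedMuAtTwo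

/-- **The analytic child 21437 `SignedMuAnalyticAtTwoPlus` from {PUB⁵ item 27435, Lenstra 1977 (8.3) (print), ERH}** —
`signedMuAnalyticAtTwoPlus_of_pub_of_artin` with (AP₃) supplied by `artinProgression_of_ERH`. Conditional; BSD is not proved by
this. [cite: Lenstra1977, Thm. (8.3)] [cite: Moree1999, Thm. 2 and Thm. 4] [cite: AbbesUllmo1996, Thm. A] -/
theorem signedMuAnalyticAtTwoPlus_of_pub_of_ERH (hPub : PublishedInputsHeckeAtTwo)
    (hLM : Literature.NumberTheory.Multiplicative.lenstra1977_exists_prime_two_primitiveRoot_progression_of_ERH)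
    (hERH : Literature.NumberTheory.LFunctions.ExtendedRiemannHypothesis) : SignedMuAnalyticAtTwoPlus :=
  signedMuAnalyticAtTwoPlus_of_pub_of_artin hPub (artinProgression_of_ERH hLM hERH)

/-- **The crux Kμ⁺ BY NAME from {seed item 21438, PUB⁵ item 27435, Lenstra 1977 (8.3) (print), ERH}.** Conditional; BSD is not
proved by this. [cite: Greenberg1999LNM, Conj. 1.11] [cite: Lenstra1977, Thm. (8.3)] [cite: AbbesUllmo1996, Thm. A] -/
theorem signedMuVanishingAtTwoPlus_of_seed_of_pub_of_ERH (hSeed : SignedMuSeedAtTwoPlus) (hPub : PublishedInputsHeckeAtTwo)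
    (hLM : Literature.NumberTheory.Multiplicative.lenstra1977_exists_prime_two_primitiveRoot_progression_of_ERH)
    (hERH : Literature.NumberTheory.LFunctions.ExtendedRiemannHypothesis) : SignedMuVanishingAtTwoPlus :=
  signedMuVanishingAtTwoPlus_of_seed_of_pub_of_artin hSeed hPub (artinProgression_of_ERH hLM hERH)

/-- **Granted {PUB⁵ item 27435, Lenstra 1977 (8.3) (print)} and ERH, the crux Kμ⁺ IS the μ-seed item 21438.** Conditional;
BSD is not proved by this. [cite: Greenberg1999LNM, Conj. 1.11] [cite: Lenstra1977, Thm. (8.3)] -/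
theorem signedMuVanishingAtTwoPlus_iff_seed_of_pub_of_ERH (hPub : PublishedInputsHeckeAtTwo)
    (hLM : Literature.NumberTheory.Multiplicative.lenstra1977_exists_prime_two_primitiveRoot_progression_of_ERH)
    (hERH : Literature.NumberTheory.LFunctions.ExtendedRiemannHypothesis) :
    SignedMuVanishingAtTwoPlus ↔ SignedMuSeedAtTwoPlus :=
  signedMuVanishingAtTwoPlus_iff_seed_of_pub_of_artin hPub (artinProgression_of_ERH hLM hERH)

/-- **THE READING OF RECORD (line `birth` v4.8).** Granted the print facts GZK (`rank_eq_analyticRank_of_analyticRank_le_one`),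
PUB⁵ (`PublishedInputsHeckeAtTwo`, item 27435; only Abbes–Ullmo Thm A is used) and Hooley–Lenstra–Moree
(`lenstra1977_exists_prime_two_primitiveRoot_progression_of_ERH`), and granted ERH, the crux Kμ⁺ `SignedMuVanishingAtTwoPlus` is
EQUIVALENT to its algebraic μ-clause alone: «for every habitat⁺ curve `W` (non-CM, analytic rank `0`, good supersingular at `2`,
`a₂ = 0`, `Δ_W < 0`), every cyclotomic `ℤ₂`-extension `κ` with topological generator `γ`, and every finitely generated `+` signed
Selmer dual datum `D`, `μ(D.X) = 0`» — Greenberg's Conj. 1.11 in Kobayashi's signed setting at `p = 2`. The torsion clause comes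
from GZK + Poitou–Tate (`…TorsionClause`), the analytic conjunct from the cusp-span node under ERH (`…LineV47` + rtt-p3-w5's ERH
closer). Conditional; nothing is closed; BSD is not proved by this.
[cite: Greenberg1999LNM, Conj. 1.11] [cite: Kobayashi2003, Thm. 1.2] [cite: Lenstra1977, Thm. (8.3)] [cite: Kolyvagin1990, Thm. A] -/
theorem signedMuVanishingAtTwoPlus_iff_mu_eq_zero_of_GZK_of_pub_of_ERH (hGZK : rank_eq_analyticRank_of_analyticRank_le_one)
    (hPub : PublishedInputsHeckeAtTwo)
    (hLM : Literature.NumberTheory.Multiplicative.lenstra1977_exists_prime_two_primitiveRoot_progression_of_ERH)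
    (hERH : Literature.NumberTheory.LFunctions.ExtendedRiemannHypothesis) :
    SignedMuVanishingAtTwoPlus ↔
      (∀ (W : WeierstrassCurve ℚ) [W.IsElliptic] [W.IsGloballyMinimal], ¬ W.HasCM → W.analyticRank = 0 →
        GoodSS W 2 → W.frobeniusTrace 2 = 0 → W.Δ < 0 →
        ∀ (κ : ZpExtension ℚ 2) (γ : Field.absoluteGaloisGroup ℚ), κ.IsCyclotomic → κ.IsTopGenerator γ →
        ∀ (D : SignedSelmerDualData W κ γ 1) [Module.Finite (IwasawaAlgebra 2) D.X], D.mu = 0) :=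
  (signedMuVanishingAtTwoPlus_iff_analytic_and_mu_eq_zero_of_GZK hGZK).trans
    ⟨fun h ↦ h.2, fun h ↦ ⟨signedMuAnalyticAtTwoPlus_of_pub_of_ERH hPub hLM hERH, h⟩⟩

/-- **The research residue forces residual Conjecture A at `2` on the habitat⁺.** Granted GZK, the μ-clause of the reading above
implies that `Sel₀(W/ℚ_∞)[2]` is finite for every habitat⁺ curve and every cyclotomic `κ` (through
`signedMuSeedAtTwoPlus_iff_mu_eq_zero_of_GZK` and `fineResidualFinite_of_signedMuSeedAtTwoPlus`); by crux-ideate k1g8's E1 this is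
Iwasawa's `μ₂ = 0` for the cubic 2-division field `L_W`. So no proof of Kμ⁺ can avoid a uniform `μ₂ = 0` mechanism on that family
of `S₃`-cubics. BSD is not proved by this. [cite: CoatesSujatha2005, Conj. A and §3] [cite: Greenberg1999LNM, Conj. 1.11] -/
theorem fineResidualFinite_of_mu_eq_zero (hGZK : rank_eq_analyticRank_of_analyticRank_le_one)
    (hμ : ∀ (W : WeierstrassCurve ℚ) [W.IsElliptic] [W.IsGloballyMinimal], ¬ W.HasCM → W.analyticRank = 0 →
        GoodSS W 2 → W.frobeniusTrace 2 = 0 → W.Δ < 0 →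
        ∀ (κ : ZpExtension ℚ 2) (γ : Field.absoluteGaloisGroup ℚ), κ.IsCyclotomic → κ.IsTopGenerator γ →
        ∀ (D : SignedSelmerDualData W κ γ 1) [Module.Finite (IwasawaAlgebra 2) D.X], D.mu = 0) :
    ∀ (W : WeierstrassCurve ℚ) [W.IsElliptic] [W.IsGloballyMinimal], ¬ W.HasCM → W.analyticRank = 0 →
      GoodSS W 2 → W.frobeniusTrace 2 = 0 → W.Δ < 0 →
      ∀ (κ : ZpExtension ℚ 2), κ.IsCyclotomic → {s : W.fineSelmerInfty κ | 2 • s = 0}.Finite :=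
  fineResidualFinite_of_signedMuSeedAtTwoPlus ((signedMuSeedAtTwoPlus_iff_mu_eq_zero_of_GZK hGZK).mpr hμ)

end Summit.BirchSwinnertonDyer.BirchSwinnertonDyer.Theorems.SignedMuAtTwo

end
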